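import Mathlib
import Summits.ValiantsHypothesis.ValiantsHypothesis.Theorems.KPlusLogSqLawWeakLiftingTowerGraftRealEvents
import Summits.ValiantsHypothesis.ValiantsHypothesis.Theorems.KPlusLogSqLawWeakLiftingTowerGraftRankOneGraft
import Summits.ValiantsHypothesis.ValiantsHypothesis.Theorems.LacunarySymmetroidMatrixDescartesDegreeCeiling

/-!
# Tower graft line — REAL EVENTS OF THE CORNER GRAFT ARE CHARGED TWICE TO THE CLASS BUDGET (T1, one-sided, pencil currency)

Mechanism file for the line `Cruxes/WeakLifting/Lines/tower_graft.lean` (crux `WeakLifting` = stmt-ValiantsHypothesis-19561,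
memo `tower_graft-S5.md` §3 T1); the pencil-currency corollary of `…TowerGraftRealEvents.lean`
(`card_posRoots_add_X_pow_mul_le_of_realEvents`: one-sided in-sector real events cost two crossings each).  NO stub is claimed.

THE COROLLARY.  Corner graft of the line (S4b's object, lift-p3's class-form spelling `det (G + X^D • E₀₀) = det G + X^D·det G₀₀`,
`det_add_smul_single_zero`): `G = Σₗ X^{dₗ} Sₗ` of size `m+1` with exponents `dₗ ≤ dmax`, steepness `4·(2m+1)·dmax ≤ s·D`
(LINEAR in the digit degrees `(m+1)·dmax`, `m·dmax` — `DegreeCeiling.natDegree_det_pencil_le`).  If the minor `det G₀₀` is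
sector-free (all complex roots satisfy `s·‖z‖ ≤ |Im z| ∨ Re z ≤ 0`) and every complex root of `det G` is off the sector or a
positive real, then
`#{t > 0 : det(G + X^D E₀₀)(t) = 0} ≤ 2·#{t > 0 : det G(t) = 0} + 1` (`card_posRoots_cornerGraft_le_of_realEvents`),
hence `≤ 2B + 1` for symmetric letters under the class budget `PosRootLawOn (m+1) K B d`
(`card_posRoots_cornerGraft_le_budget_of_realEvents`): in this regime the corner graft's excess over the base budget is a FACTOR 2
and an additive 1 — the shape `2^C·B + …` of `TowerGraftLawCorner` with `C = 1`, charged event by event.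

HONEST FRAMING.  The regime is one-sided (sector-free minor, no non-real in-sector roots of `det G`); the general corner graft has
events in BOTH digits and non-real near-axis events (memo T1-CORNER §3: mixed clusters OPEN; then T2 must budget the in-sector
events of class determinants on a tower).  Nothing on S4/S4b/S5, TowerB, `WeakLifting`, Conjecture B, `MatrixDescartes` (18050) or
`VP ≠ VNP`.  Def-free.  Seat: prover val-sym-lift-p1 g20, `--supports stmt-ValiantsHypothesis-19561`.
-/

-- `Summit.ValiantsHypothesis.ValiantsHypothesis.…` repeats a component by the D-0017 layout
-- (single-conjunct summit), which the `dupNamespace` linter flags; the name is mandated.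
set_option linter.dupNamespace false

namespace Summit.ValiantsHypothesis.ValiantsHypothesis.Theorems.KPlusLogSqLaw.TowerGraft

open Polynomial
open scoped BigOperators Polynomial
open Summit.ValiantsHypothesis.ValiantsHypothesis.Theorems.LacunarySymmetroidMatrixDescartes (PosRootLawOn)

section Corner

variable {m : ℕ}

/-- **CORNER GRAFT, ONE-SIDED REAL EVENTS.**  `G = Σₗ X^{dₗ} Sₗ` of size `m+1`, `dₗ ≤ dmax`, `4·(2m+1)·dmax ≤ s·D`, `0 < s ≤ 1`;
if `det G ≠ 0`, `det G₀₀ ≠ 0`, every complex root of `det G₀₀` is off the sector and every complex root of `det G` is off the sector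
or a positive real, then `#{t > 0 : det(G + X^D·E₀₀)(t) = 0} ≤ 2·#{t > 0 : det G (t) = 0} + 1`.  (No symmetry, tower or budget
hypothesis is needed for this count.) [this work] -/
theorem card_posRoots_cornerGraft_le_of_realEvents {K : ℕ} (d : Fin K → ℕ) (dmax D : ℕ) (hd : ∀ l, d l ≤ dmax)
    (S : Fin K → Matrix (Fin (m + 1)) (Fin (m + 1)) ℝ) {s : ℝ} (hs : 0 < s) (hs1 : s ≤ 1)
    (hsteep : 4 * (((m : ℝ) + 1 + m) * dmax) ≤ s * D)
    (hG : (∑ l, ((X : ℝ[X]) ^ d l) • (S l).map C).det ≠ 0)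
    (hG₀ : (∑ l, ((X : ℝ[X]) ^ d l) • ((S l).submatrix Fin.succ Fin.succ).map C).det ≠ 0)
    (hrG : ∀ z ∈ ((∑ l, ((X : ℝ[X]) ^ d l) • (S l).map C).det.map Complex.ofRealHom).roots,
      (s * ‖z‖ ≤ |z.im| ∨ z.re ≤ 0) ∨ (z.im = 0 ∧ 0 < z.re))
    (hrG₀ : ∀ z ∈ ((∑ l, ((X : ℝ[X]) ^ d l) • ((S l).submatrix Fin.succ Fin.succ).map C).det.map
      Complex.ofRealHom).roots, s * ‖z‖ ≤ |z.im| ∨ z.re ≤ 0) :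
    (((∑ l, ((X : ℝ[X]) ^ d l) • (S l).map C) +
          (X : ℝ[X]) ^ D • Matrix.single (0 : Fin (m + 1)) (0 : Fin (m + 1)) (1 : ℝ[X])).det.roots.toFinset.filter
        (fun t => 0 < t)).card ≤
      2 * ((∑ l, ((X : ℝ[X]) ^ d l) • (S l).map C).det.roots.toFinset.filter (fun t => 0 < t)).card + 1 := by
  set G := ∑ l, ((X : ℝ[X]) ^ d l) • (S l).map C with hGdef
  have hGsub : G.submatrix Fin.succ Fin.succ =
      ∑ l, ((X : ℝ[X]) ^ d l) • ((S l).submatrix Fin.succ Fin.succ).map C := by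
    refine Matrix.ext fun i j => ?_
    simp [hGdef, Matrix.submatrix_apply, Matrix.sum_apply, Matrix.smul_apply, Matrix.map_apply]
  rw [det_add_smul_single_zero, hGsub]
  have hdegA : (G.det.natDegree : ℝ) ≤ (m + 1) * dmax := by
    exact_mod_cast LacunarySymmetroidMatrixDescartes.DegreeCeiling.natDegree_det_pencil_le d S dmax hd
  have hdegE : ((∑ l, ((X : ℝ[X]) ^ d l) • ((S l).submatrix Fin.succ Fin.succ).map C).det.natDegree : ℝ)
      ≤ m * dmax := by
    exact_mod_cast LacunarySymmetroidMatrixDescartes.DegreeCeiling.natDegree_det_pencil_le d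
      (fun l => (S l).submatrix Fin.succ Fin.succ) dmax hd
  refine card_posRoots_add_X_pow_mul_le_of_realEvents hs hs1 _ _ D hG hG₀ hrG hrG₀ ?_
  have : ((m : ℝ) + 1 + m) * dmax = (m + 1) * dmax + m * dmax := by ring
  linarith

/-- **… hence twice the class budget plus one.**  With symmetric letters and the class budget `PosRootLawOn (m+1) K B d` on the
support, the corner graft of the previous theorem has at most `2B + 1` positive zeros — the `2^C·B + …` shape of the line's
`TowerGraftLawCorner` with `C = 1`, in the one-sided real-event regime. [this work] -/
theorem card_posRoots_cornerGraft_le_budget_of_realEvents {K B : ℕ} (d : Fin K → ℕ) (dmax D : ℕ) (hd : ∀ l, d l ≤ dmax)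
    (hB : PosRootLawOn (m + 1) K B d)
    (S : Fin K → Matrix (Fin (m + 1)) (Fin (m + 1)) ℝ) (hS : ∀ l, (S l).IsSymm) {s : ℝ} (hs : 0 < s) (hs1 : s ≤ 1)
    (hsteep : 4 * (((m : ℝ) + 1 + m) * dmax) ≤ s * D)
    (hG : (∑ l, ((X : ℝ[X]) ^ d l) • (S l).map C).det ≠ 0)
    (hG₀ : (∑ l, ((X : ℝ[X]) ^ d l) • ((S l).submatrix Fin.succ Fin.succ).map C).det ≠ 0)
    (hrG : ∀ z ∈ ((∑ l, ((X : ℝ[X]) ^ d l) • (S l).map C).det.map Complex.ofRealHom).roots,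
      (s * ‖z‖ ≤ |z.im| ∨ z.re ≤ 0) ∨ (z.im = 0 ∧ 0 < z.re))
    (hrG₀ : ∀ z ∈ ((∑ l, ((X : ℝ[X]) ^ d l) • ((S l).submatrix Fin.succ Fin.succ).map C).det.map
      Complex.ofRealHom).roots, s * ‖z‖ ≤ |z.im| ∨ z.re ≤ 0) :
    (((∑ l, ((X : ℝ[X]) ^ d l) • (S l).map C) +
          (X : ℝ[X]) ^ D • Matrix.single (0 : Fin (m + 1)) (0 : Fin (m + 1)) (1 : ℝ[X])).det.roots.toFinset.filter
        (fun t => 0 < t)).card ≤ 2 * B + 1 := by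
  have h1 := card_posRoots_cornerGraft_le_of_realEvents d dmax D hd S hs hs1 hsteep hG hG₀ hrG hrG₀
  have h2 := hB S hS
  omega

end Corner

end Summit.ValiantsHypothesis.ValiantsHypothesis.Theorems.KPlusLogSqLaw.TowerGraft
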